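import Literature.MathematicalPhysics.QuantumFieldTheory.Balaban1983to89.B3Ineq25Op116RegularTorus
import Literature.MathematicalPhysics.QuantumFieldTheory.Balaban1983to89.B3Op116HolderKernelRegularRegion
import Literature.MathematicalPhysics.QuantumFieldTheory.Balaban1983to89.B3Op116MixedKernelRegularRegion

/-!
# Bałaban, *(Higgs)₂,₃ quantum fields in a finite volume III. Renormalization* [B3] — inequality (2.5) p. 424, THE (1.16) ALTERNATIVE,
ON A REGION `Ω ⊆ T_ε` UNDER PRINT'S SUPPORT HYPOTHESIS (p. 412) AT THE ONE-SIDED ORDERS `(0, n′)` AND `(n, 0)` (`n, n′ > d`), FROM THE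
(2.10)/(2.11)/mixed-(2.10) BOUNDS AT INTERIOR PAIRS: the region twin of p35's `B3Ineq25Op116RegularTorusOneSided` (the one-sided corner of
p40's region assembly R5 `B3Ineq25Op116RegularRegion`, B3-CLOSURE §5 item 20)

statement-level skeleton of published theorems with citation tags; proofs where landed; nothing here is a claim about the Yang–Mills mass gap

T. Bałaban, Commun. Math. Phys. **88** (1983) 411–445 [cite: Balaban1983Higgs3]; part I, Commun. Math. Phys. **85** (1982) 603–636
[cite: Balaban1982Higgs1]; *Regularity and decay of lattice Green's functions*, Commun. Math. Phys. **89** (1983) 571–597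
[cite: Balaban1983RegularityDecay].  PDFs held: `paper:balaban1983-higgs-2-3-quantum-fields-finite-volume` (journal page = PDF page + 410;
p. 412 = `p0002.txt`, p. 414 = `p0004.txt`, p. 424 = `p0014.txt`, p. 426 = `p0016.txt`), `paper:balaban1982-cmp85-higgs23-i` (p. 619–620 =
`p0017.txt`–`p0018.txt`).

CITATION HEADER (lean-in-tree rule).  Cell `lit-balaban` (HOME `run/shared/lean/pub/lit-balaban/`), proof seat **p35** gen 23
(unit `lit-balaban-p35`); p40 g75's region programme (HOME/STATUS 2026-08-23T09:21:23Z; R1 `B3Op116RegionSources`, R2 `B3Op116DKernelRegularRegion`,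
R3 = p35's `B3Op116HolderKernelRegularRegion`, R4a/b `B3Op116MixedSeedRegion`/`B3Op116MixedKernelRegularRegion`, R5 `B3Ineq25Op116RegularRegion`);
division of labour as on the torus (p40 → p35 2026-08-23T08:46:56Z *«p35 do it»*; p35 → p40 10:50Z): the ONE-SIDED orders are p35's.
SKELETON rows **B3.Eq2.5** (decl of record `B3Sect2StatementsPart2.ScaledKernels.Ineq25At`, fold owner r15) / **B3.Eq1.16** (analytic half) —
LOCATED MEMBER, no head claim.  USED BY NAME, never restated: p40's `B3Ineq25Op116Smooth.ineq25At_op116_smooth_of_bounds` ((2.5) on nested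
regions from eight kernel-entry binders at interior points), `B3Ineq25Op116RegularTorus.{entry_mono, entry_mono_holder}`, the region binder
suppliers `B3Op116DKernelRegularRegion.{kernel116_value_le_region, kernel116_deriv_le_region}` (p40 R2), `B3Op116HolderKernelRegularRegion.{kernel116_holder_le_region,
kernel116_holder_le_zero_left_region'}` (p35 R3 v1.1), `B3Op116MixedKernelRegularRegion.kernel116_mixed_le_region` (p40 R4b), the torus constants
`valC/derC/holC/mixC/rateAt` (p35/p40) verbatim.

## What is printed (verbatim)

(2.5) p. 424 [PDF 14]: *"‖h(an operator δG_k(Ω,Ω₂,B̃) or (1.16))h′‖_{1,α} ≤ O(e^{−δ₀dist(Ω₂,∂Ω)} or (e(L^kε)p(L^kε))^{n+n′})e^{−δ₀dist(supp h,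
supp h′)}, (2.5)"*;  (1.16) p. 414 [PDF 4]: *"[G_k(Ω,B̃)V_k(Ã,B̃)]^n G_k(Ω,Ã+B̃) [V_k(Ã,B̃)G_k(Ω,B̃)]^{n′}, (1.16) … for n, n′ sufficiently
large, a kernel of the operator (1.16) is a sufficiently regular function of both variables"*;  p. 412 [PDF 2]: *"we will assume that |A|,
|∂^ηA|, |∂^ηB| and their Hölder norms … ≤ O(1)p(L^kε) and dist(supp A, ∂Ω) > 2r(L^kε)"*;  [B1] p. 620 (3.45) [PDF 18]: the ONE-SIDED expansion
whose remainder is (1.16) at `(n̄, 0)` — the orders `(n, 0)`, `(0, n′)` are the ones the inductive renormalization uses first.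

## What this file proves, and how

**`ineq25At_op116_regularRegion_zero_left`** (`(0, n′)`, `d < n′`) and **`ineq25At_op116_regularRegion_zero_right`** (`(n, 0)`, `d < n`):
for nested regions `Ω₂ ⊆ Ω ⊆ T_ε`, GIVEN r15's (2.10) bounds `Ineq210 δ₁ C` of `G_k(Ω,B̃)`, `G_k(Ω,Ã+B̃)` on r14's carrier `regRegionKernels … Ω … K₀`
(interior pairs), their twice-differentiated per-piece form `C_M` at interior pairs, the region (2.11) row of `G_k(Ω,B̃)` at interior points with
constant `cH`, the `δG_k` clause of the carrier at `(δ_G, C_G)`, `Ã` small (`sup|Ã_b| ≤ s`, `(L^kε)|e|s ≤ 1`), (I.2.23)-regular (`δ_A`) and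
SUPPORTED ON DEEP BONDS (`Ã_b ≠ 0 ⇒ DeepBlk b₋ ∧ DeepBlk b₊`, print p. 412), `L^kε ≤ e_Rp_R`, `L^kε ≤ 1`, `L ≥ 2`, `1 ≤ k ≤ K`, `0 ≤ α < 1`:
`(sect2Smooth116 hL1 C Ω Ω₂ Ã B̃ …).Ineq25At 0 n′ α (min δ_G (δ₁/(4L)^{n′+1})) (C_G + K(c₁,c₂+2c₁,d,m)(valC(n′)+derC(n′)) + (holC(n′−1)+holC(n′)) + d·m·mixC(n′))`
and the same at `(n, 0)` — p35's torus proof verbatim with three `Interior` guards threaded: p40's `ineq25At_op116_smooth_of_bounds` fed with the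
eight region binders (value/derivative ← R2, Hölder ← R3 v1.1 `kernel116_holder_le_zero_left_region'` at `(0,·)` and `kernel116_holder_le_region` at
`(·−1, 0)`, mixed ← R4b), all weakened to the common rate `δ₁/(4L)^{n+n′+1}` and the factor `(e_Rp_R)^{n+n′}` by p40's `entry_mono`/`entry_mono_holder`.

## Honest scope

Exactly the torus one-sided member's scope with `T_ε` replaced by print's region under print's support hypothesis: inputs at INTERIOR pairs only
(r14's `R₀`-margin `Interior k K₀ Ω`, ONE `K₀` for the carrier and the (2.10) inputs), conclusion for the smooth localization functions of the
carrier; `n′ > d` (resp. `n > d`); constants explicit but not optimized; the (2.10)/(2.11)/mixed inputs are HYPOTHESES here (the hypothesis-free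
member under print's regime is the sibling `B3Ineq25Op116RegionOneSided`, after p40's R5(C)).  Theorems only: no `def`, no new named fact, no
`sorry`; axioms standard.  Value = located member of a by-reference step of B3 — NOT summit progress and nothing about the Yang–Mills mass gap.
-/

noncomputable section

open scoped BigOperators

namespace Literature.MathematicalPhysics.QuantumFieldTheory.Balaban1983to89.B3Ineq25Op116RegularRegionOneSided

open HiggsLattice (ChargeData ScalarField covDeriv)
open HiggsCovariance (propagatorK E)
open B1Eq230FluctCov (Ix cb)
open B1TorusChainTransport (hol)
open B3Ineq210RegularRegion (regRegionKernels Interior)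
open B3Ineq211RegularTorus (IsAdm)
open B3Ineq25SmoothLocalization (sect2DeltaSmooth)
open B3Ineq31SmoothLocalization (smoothConst)
open B3Ineq25Op116Smooth (sect2Smooth116 ineq25At_op116_smooth_of_bounds)
open B3Op116DKernelRegularTorus (valC derC valC_nonneg derC_nonneg rateAt rateAt_closed cK1)
open B3Op116DKernelRegularRegion (kernel116_value_le_region kernel116_deriv_le_region)
open B3Op116HolderKernelRegularTorus (holC holC_nonneg)
open B3Op116HolderKernelRegularRegion (kernel116_holder_le_region kernel116_holder_le_zero_left_region')
open B3Op116RegionSources (DeepBlk)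
open B3Op116MixedKernelRegularTorus (mixC mixC_nonneg mixRate_eq dipRate cvDip cdDip)
open B3Op116MixedKernelRegularRegion (kernel116_mixed_le_region)
open B3Ineq25Op116RegularTorus (entry_mono entry_mono_holder)
open B3Eq116TwoSidedExpansion (op116)

variable {P : HiggsLattice.Params} {N : ℕ}

section Main

variable {k K₀ r₀ m : ℕ} {hL1 : 1 < P.L} {C : ChargeData N} {Ω Ω₂ : Finset (HiggsLattice.Site P 0)} {A B : HiggsLattice.VecField P 0}
  {msq a : ℝ} {c₁ c₂ eR pR : ℝ} {δ₁ Cst CM s δA cH : ℝ}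

set_option maxHeartbeats 800000 in
/-- **(2.5), THE (1.16) ALTERNATIVE, ON A REGION AT THE ORDERS `(0, n′)`, `d < n′`** (outer left factor `G_k(Ω,Ã+B̃)`): for nested regions
`Ω₂ ⊆ Ω`, under the (2.10)/(2.11)/mixed-(2.10) bounds of `G_k(Ω,B̃)`, `G_k(Ω,Ã+B̃)` at interior pairs (one `K₀`), the `δG_k` clause, `Ã` small,
regular and supported on deep bonds (print p. 412), `L^kε ≤ e_Rp_R`, `L^kε ≤ 1`,
`(sect2Smooth116 …).Ineq25At 0 n′ α (min δ_G (δ₁/(4L)^{n′+1})) (C_G + K(c₁,c₂+2c₁,d,m)(valC(n′)+derC(n′)) + (holC(n′−1)+holC(n′)) + d·m·mixC(n′))`.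
[cite: Balaban1983Higgs3, (2.5) p.424, (1.16) p.414, p.412, (1.32) p.420, (2.10)-(2.11) p.426] [cite: Balaban1982Higgs1, Prop. 2.1 (2.24)-(2.25) p.610, (3.44)-(3.45) p.619] [cite: Balaban1983RegularityDecay, Theorem p.573] -/
theorem ineq25At_op116_regularRegion_zero_left (hL2 : 2 ≤ P.L) (hk : 1 ≤ k) (hkK : k ≤ P.K) (hΩ : Ω₂ ⊆ Ω) (hmsq : 0 < msq) (ha : 0 < a)
    (hmesh : P.mesh k ≤ 1) (n' : ℕ) (hd : P.d < n')
    {α δG CG : ℝ} (hα0 : 0 ≤ α) (hα1 : α < 1) (hc₁ : 0 ≤ c₁) (hc₂ : 0 ≤ c₂) (ht0 : 0 ≤ eR * pR) (ht : P.mesh k ≤ eR * pR)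
    (hCG : 0 ≤ CG) (hδG : (sect2DeltaSmooth hL1 C Ω Ω₂ B msq a k K₀ r₀ m c₁ c₂).Ineq25 α δG CG)
    (hδ₁ : 0 < δ₁) (hδ₁1 : δ₁ ≤ 1) (hCst : 0 ≤ Cst) (hCM : 0 ≤ CM)
    (h210B : (regRegionKernels hL1 C Ω B msq a k K₀).Ineq210 δ₁ Cst)
    (hmixB : ∀ (j : ℕ) (μ ν : Fin P.d) (x x' : HiggsLattice.Site P 0), Interior k K₀ Ω x → Interior k K₀ Ω x' →
      B3Ineq210MixedRegularRegion.mixedTermR C Ω B msq a k j μ ν x x'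
        ≤ CM * (P.mesh j ^ P.d)⁻¹ * Real.exp (-(δ₁ * ((HiggsLattice.Site.tdist x x' : ℝ) / (P.L : ℝ) ^ j))))
    (h210AB : (regRegionKernels hL1 C Ω (A + B) msq a k K₀).Ineq210 δ₁ Cst)
    (hmixAB : ∀ (j : ℕ) (μ ν : Fin P.d) (x x' : HiggsLattice.Site P 0), Interior k K₀ Ω x → Interior k K₀ Ω x' →
      B3Ineq210MixedRegularRegion.mixedTermR C Ω (A + B) msq a k j μ ν x x'
        ≤ CM * (P.mesh j ^ P.d)⁻¹ * Real.exp (-(δ₁ * ((HiggsLattice.Site.tdist x x' : ℝ) / (P.L : ℝ) ^ j))))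
    (i₀ : Ix N) (hs : 0 ≤ s) (hA : ∀ b : HiggsLattice.PBond P 0, |A b| ≤ s) (hδA : 0 ≤ δA)
    (hregA : ∀ (z : HiggsLattice.Site P 0) (μ ν : Fin P.d), |A ⟨z.shift ν, μ⟩ - A ⟨z, μ⟩| ≤ δA)
    (hAS : ∀ b : HiggsLattice.PBond P 0, A b ≠ 0 → DeepBlk k K₀ Ω b.src ∧ DeepBlk k K₀ Ω b.tgt)
    (ht1 : P.mesh k * (|C.e| * s) ≤ 1) (hcH : 0 ≤ cH)
    (h211 : ∀ (μ : Fin P.d) (x₁ x₂ y : HiggsLattice.Site P 0), Interior k K₀ Ω x₁ → Interior k K₀ Ω x₂ → Interior k K₀ Ω y →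
      x₁ ≠ x₂ → ∀ Γ : List (HiggsLattice.Site P 0), IsAdm x₁ x₂ Γ →
      (∑ i : Ix N, ‖hol C B x₁ Γ (covDeriv C B (propagatorK C Ω B msq a k (cb P N 0 (y, i))) ⟨x₂, μ⟩)
          - covDeriv C B (propagatorK C Ω B msq a k (cb P N 0 (y, i))) ⟨x₁, μ⟩‖)
          / (P.mesh 0 * (HiggsLattice.Site.tdist x₁ x₂ : ℝ)) ^ α
        ≤ ∑ j ∈ Finset.range k, cH * P.mesh j ^ (((1 : ℝ) - α) - (P.d : ℝ)) *
            (Real.exp (-(δ₁ * (P.mesh j)⁻¹ * (P.mesh 0 * (HiggsLattice.Site.tdist x₁ y : ℝ)))) +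
              Real.exp (-(δ₁ * (P.mesh j)⁻¹ * (P.mesh 0 * (HiggsLattice.Site.tdist x₂ y : ℝ)))))) :
    (sect2Smooth116 hL1 C Ω Ω₂ A B msq a k K₀ r₀ m c₁ c₂ eR pR).Ineq25At 0 n' α
      (min δG (δ₁ / (4 * (P.L : ℝ)) ^ (n' + 1)))
      (CG + (smoothConst P.d m c₁ (c₂ + 2 * c₁) *
          (valC P N C k a δ₁ Cst s δA n' + derC P N C k a δ₁ Cst s δA n')
        + ((holC P N C k a δ₁ Cst s δA α cH (n' - 1) + holC P N C k a δ₁ Cst s δA α cH n')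
          + P.d * m * mixC P N C k a δ₁ Cst CM s δA n'))) := by
  have hL : 1 < P.L := hL1
  have hL1r : (1 : ℝ) ≤ (P.L : ℝ) := by exact_mod_cast P.hL
  have hn' : 1 ≤ n' := by have := P.hd; omega
  obtain ⟨m₂, rfl⟩ : ∃ m₂, n' = m₂ + 1 := ⟨n' - 1, by omega⟩
  have hdm : (P.d : ℝ) < (m₂ : ℝ) + 1 := by exact_mod_cast hd
  set M := m₂ + 1 with hM
  have hM1 : M - 1 = m₂ := by omega
  have hM12 : M - 1 + 2 = M + 1 := by omega
  -- thresholds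
  have hdM : (P.d : ℝ) < (M : ℝ) := by exact_mod_cast hd
  have hdV : (P.d : ℝ) < ((0 + (m₂ + 1) : ℕ) : ℝ) + 2 := by push_cast; linarith
  have hdV' : (P.d : ℝ) < ((m₂ + 1 + 0 : ℕ) : ℝ) + 2 := by push_cast; linarith
  have hdD : (P.d : ℝ) < ((0 + (m₂ + 1) : ℕ) : ℝ) + 1 := by push_cast; linarith
  have hdD' : (P.d : ℝ) < ((m₂ + 1 + 0 : ℕ) : ℝ) + 1 := by push_cast; linarith
  have hdH : (P.d : ℝ) < 1 + ((m₂ + 1 : ℕ) : ℝ) - α := by push_cast; linarith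
  have hdH' : (P.d : ℝ) < 1 + ((m₂ + 1 + 0 : ℕ) : ℝ) - α := by push_cast; linarith
  have hdHM : (P.d : ℝ) < 1 + ((M + 1 : ℕ) : ℝ) - α := by push_cast; linarith
  have hd0 : P.d < 0 + (m₂ + 1) := by omega
  have hd0' : P.d < m₂ + 1 + 0 := by omega
  -- signs of the constants
  have hCV : 0 ≤ valC P N C k a δ₁ Cst s δA M := valC_nonneg hL hδ₁ hCst hs hδA M (by linarith)
  have hCD : 0 ≤ derC P N C k a δ₁ Cst s δA M := derC_nonneg hL hδ₁ hCst hs hδA M (by linarith)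
  have hCH0 : 0 ≤ holC P N C k a δ₁ Cst s δA α cH (M - 1) := by
    rw [hM1]; exact holC_nonneg hL hδ₁ hCst hs hδA hα1 hcH m₂ hdH
  have hCH1 : 0 ≤ holC P N C k a δ₁ Cst s δA α cH M := holC_nonneg hL hδ₁ hCst hs hδA hα1 hcH M hdHM
  have hCH : 0 ≤ holC P N C k a δ₁ Cst s δA α cH (M - 1) + holC P N C k a δ₁ Cst s δA α cH M := add_nonneg hCH0 hCH1
  have hCM' : 0 ≤ mixC P N C k a δ₁ Cst CM s δA M := mixC_nonneg hL hδ₁ hCst hCM ha.le hs hδA (by omega)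
  -- the common rate
  set δ : ℝ := δ₁ / (4 * (P.L : ℝ)) ^ (M + 1) with hδdef
  have h4L : (1 : ℝ) ≤ 4 * (P.L : ℝ) := by linarith
  have h4L0 : (0 : ℝ) < 4 * (P.L : ℝ) := by linarith
  have hδ0 : 0 ≤ δ := div_nonneg hδ₁.le (pow_nonneg h4L0.le _)
  have hδU : δ ≤ rateAt P N C k a Cst s δA δ₁ (P.mesh 0 ^ P.d * Cst) (cK1 P C k Cst s) M := by
    rw [rateAt_closed]
    exact div_le_div_of_nonneg_left hδ₁.le (pow_pos h4L0 _) (pow_le_pow_right₀ h4L (Nat.le_succ M))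
  have hδU1 : δ ≤ rateAt P N C k a Cst s δA δ₁ (P.mesh 0 ^ P.d * Cst) (cK1 P C k Cst s) (M + 1) := by
    rw [rateAt_closed]
  have hδmix : δ ≤ rateAt P N C k a Cst s δA (dipRate P δ₁) (cvDip P N C k a δ₁ Cst CM s δA) (cdDip P N C k a δ₁ Cst CM s δA)
      (M - 1) := by
    rw [mixRate_eq, hM12]
  -- scale factors and geometry
  have hmk : 0 ≤ P.mesh k := (P.mesh_pos k).le
  have hpowM : P.mesh k ^ M ≤ (eR * pR) ^ M := pow_le_pow_left₀ hmk ht M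
  have heM : 0 ≤ P.mesh k ^ M := pow_nonneg hmk M
  have hG2 : 0 ≤ P.mesh k ^ 2 * (P.mesh k ^ P.d)⁻¹ := by positivity
  have hG1 : 0 ≤ P.mesh k * (P.mesh k ^ P.d)⁻¹ := by positivity
  have hG0 : 0 ≤ (P.mesh k ^ P.d)⁻¹ := by positivity
  have hGH : 0 ≤ P.mesh k * (P.mesh k ^ P.d)⁻¹ * (P.mesh k ^ α)⁻¹ := by
    have := Real.rpow_nonneg hmk α; positivity
  have hLk : (0 : ℝ) < (P.L : ℝ) ^ k := by positivity
  have htd : ∀ x x' : HiggsLattice.Site P 0, (0 : ℝ) ≤ (HiggsLattice.Site.tdist x x' : ℝ) / (P.L : ℝ) ^ k :=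
    fun x x' => div_nonneg (Nat.cast_nonneg _) hLk.le
  have htdH : ∀ x₁ x₂ x' : HiggsLattice.Site P 0,
      (0 : ℝ) ≤ min (HiggsLattice.Site.tdist x₁ x' : ℝ) (HiggsLattice.Site.tdist x₂ x' : ℝ) / (P.L : ℝ) ^ k :=
    fun x₁ x₂ x' => div_nonneg (le_min (Nat.cast_nonneg _) (Nat.cast_nonneg _)) hLk.le
  have hq : ∀ x₁ x₂ : HiggsLattice.Site P 0, (0 : ℝ) ≤ (P.mesh 0 * (HiggsLattice.Site.tdist x₁ x₂ : ℝ)) ^ α :=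
    fun x₁ x₂ => Real.rpow_nonneg (mul_nonneg (P.mesh_pos 0).le (Nat.cast_nonneg _)) α
  have e0 : 0 + (m₂ + 1) = M := by omega
  have e0' : m₂ + 1 + 0 = M := by omega
  refine ineq25At_op116_smooth_of_bounds hL2 hk hkK hΩ 0 (m₂ + 1) hα0 hα1.le hc₁ hc₂ ht0 hCG hδ0 hCV hCD hCH hCM' hδG
    ?_ ?_ ?_ ?_ ?_ ?_ ?_ ?_
  · -- hV ← kernel116_value_le_region (0, n′)
    intro x x' hx hx'
    have h := kernel116_value_le_region hδ₁ hδ₁1 hCst h210B h210AB hmsq ha hk hkK i₀ hs hA hδA hregA hAS 0 (m₂ + 1) hdV x x'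
      hx hx'
    rw [e0] at h ⊢
    exact h.trans (entry_mono hCV heM hpowM hG2 hδU (htd x x'))
  · -- hV′ ← kernel116_value_le_region (n′, 0)
    intro x x' hx hx'
    have h := kernel116_value_le_region hδ₁ hδ₁1 hCst h210B h210AB hmsq ha hk hkK i₀ hs hA hδA hregA hAS (m₂ + 1) 0 hdV' x x'
      hx hx'
    rw [e0'] at h
    rw [e0]
    exact h.trans (entry_mono hCV heM hpowM hG2 hδU (htd x x'))
  · -- hDv ← kernel116_deriv_le_region (0, n′)
    intro μ x x' hx hx'
    have h := kernel116_deriv_le_region hδ₁ hδ₁1 hCst h210B h210AB hmsq ha hk hkK i₀ hs hA hδA hregA hAS 0 (m₂ + 1) hdD μ x x'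
      hx hx'
    rw [e0] at h ⊢
    exact h.trans (entry_mono hCD heM hpowM hG1 hδU (htd x x'))
  · -- hDv′ ← kernel116_deriv_le_region (n′, 0)
    intro μ x x' hx hx'
    have h := kernel116_deriv_le_region hδ₁ hδ₁1 hCst h210B h210AB hmsq ha hk hkK i₀ hs hA hδA hregA hAS (m₂ + 1) 0 hdD' μ x x'
      hx hx'
    rw [e0'] at h
    rw [e0]
    exact h.trans (entry_mono hCD heM hpowM hG1 hδU (htd x x'))
  · -- hH ← kernel116_holder_le_zero_left_region′ (0, n′): outer factor G_k(Ω,Ã+B̃)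
    intro μ x₁ x₂ x' Γ hx₁ hx₂ hx' hne hΓ
    have h := kernel116_holder_le_zero_left_region' hδ₁ hδ₁1 hCst h210B h210AB hmsq ha hk hkK i₀ hs hA hδA hregA hAS hα1 hcH h211 hmesh
      m₂ hdH μ x₁ x₂ x' hx₁ hx₂ hx' hne Γ hΓ
    rw [show m₂ + 2 = M + 1 by omega, ← hM1] at h
    rw [e0]
    exact h.trans (entry_mono_holder (hq x₁ x₂) hCH heM hpowM hGH hδU1 (htdH x₁ x₂ x'))
  · -- hH′ ← kernel116_holder_le_region (n′ − 1, 0): outer factor G_k(Ω,B̃)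
    intro μ x₁ x₂ x' Γ hx₁ hx₂ hx' hne hΓ
    have h := kernel116_holder_le_region hδ₁ hδ₁1 hCst h210B h210AB hmsq ha hk hkK i₀ hs hA hδA hregA hAS hα1 hcH h211 m₂ 0 hdH' μ
      x₁ x₂ x' hx₁ hx₂ hx' hne Γ hΓ
    rw [show m₂ + 0 = M - 1 by omega, e0'] at h
    rw [e0]
    have hK : holC P N C k a δ₁ Cst s δA α cH (M - 1) ≤
        holC P N C k a δ₁ Cst s δA α cH (M - 1) + holC P N C k a δ₁ Cst s δA α cH M := le_add_of_nonneg_right hCH1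
    refine h.trans ((entry_mono_holder (hq x₁ x₂) hCH0 heM hpowM hGH hδU (htdH x₁ x₂ x')).trans ?_)
    have hE : 0 ≤ Real.exp (-(δ * (min (HiggsLattice.Site.tdist x₁ x' : ℝ) (HiggsLattice.Site.tdist x₂ x' : ℝ) / (P.L : ℝ) ^ k))) :=
      (Real.exp_pos _).le
    have hEM : 0 ≤ (eR * pR) ^ M := pow_nonneg ht0 M
    exact mul_le_mul_of_nonneg_right (mul_le_mul_of_nonneg_left
      (mul_le_mul_of_nonneg_right (mul_le_mul_of_nonneg_right hK hEM) hGH) (hq x₁ x₂)) hE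
  · -- hM ← kernel116_mixed_le_region (0, n′)
    intro μ ν x x' hx hx'
    have h := kernel116_mixed_le_region hδ₁ hδ₁1 hCst hCM h210B hmixB h210AB hmixAB hmsq ha hk hkK i₀ hs hA hδA hregA hAS ht1
      0 (m₂ + 1) hd0 μ ν hx hx'
    rw [e0] at h ⊢
    exact h.trans (entry_mono hCM' heM hpowM hG0 hδmix (htd x x'))
  · -- hM′ ← kernel116_mixed_le_region (n′, 0)
    intro μ ν x x' hx hx'
    have h := kernel116_mixed_le_region hδ₁ hδ₁1 hCst hCM h210B hmixB h210AB hmixAB hmsq ha hk hkK i₀ hs hA hδA hregA hAS ht1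
      (m₂ + 1) 0 hd0' μ ν hx hx'
    rw [e0'] at h
    rw [e0]
    exact h.trans (entry_mono hCM' heM hpowM hG0 hδmix (htd x x'))

set_option maxHeartbeats 800000 in
/-- **(2.5), THE (1.16) ALTERNATIVE, ON A REGION AT THE ORDERS `(n, 0)`, `d < n`** (outer right factor `G_k(Ω,Ã+B̃)`; the remainder
shape of the one-sided expansion (I.3.45)): under the hypotheses of `ineq25At_op116_regularRegion_zero_left`,
`(sect2Smooth116 …).Ineq25At n 0 α (min δ_G (δ₁/(4L)^{n+1})) (C_G + K(c₁,c₂+2c₁,d,m)(valC(n)+derC(n)) + (holC(n−1)+holC(n)) + d·m·mixC(n))`.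
[cite: Balaban1983Higgs3, (2.5) p.424, (1.16) p.414, p.412, (1.32) p.420, (2.10)-(2.11) p.426] [cite: Balaban1982Higgs1, Prop. 2.1 (2.24)-(2.25) p.610, (3.44)-(3.45) p.619] [cite: Balaban1983RegularityDecay, Theorem p.573] -/
theorem ineq25At_op116_regularRegion_zero_right (hL2 : 2 ≤ P.L) (hk : 1 ≤ k) (hkK : k ≤ P.K) (hΩ : Ω₂ ⊆ Ω) (hmsq : 0 < msq) (ha : 0 < a)
    (hmesh : P.mesh k ≤ 1) (n : ℕ) (hd : P.d < n)
    {α δG CG : ℝ} (hα0 : 0 ≤ α) (hα1 : α < 1) (hc₁ : 0 ≤ c₁) (hc₂ : 0 ≤ c₂) (ht0 : 0 ≤ eR * pR) (ht : P.mesh k ≤ eR * pR)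
    (hCG : 0 ≤ CG) (hδG : (sect2DeltaSmooth hL1 C Ω Ω₂ B msq a k K₀ r₀ m c₁ c₂).Ineq25 α δG CG)
    (hδ₁ : 0 < δ₁) (hδ₁1 : δ₁ ≤ 1) (hCst : 0 ≤ Cst) (hCM : 0 ≤ CM)
    (h210B : (regRegionKernels hL1 C Ω B msq a k K₀).Ineq210 δ₁ Cst)
    (hmixB : ∀ (j : ℕ) (μ ν : Fin P.d) (x x' : HiggsLattice.Site P 0), Interior k K₀ Ω x → Interior k K₀ Ω x' →
      B3Ineq210MixedRegularRegion.mixedTermR C Ω B msq a k j μ ν x x'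
        ≤ CM * (P.mesh j ^ P.d)⁻¹ * Real.exp (-(δ₁ * ((HiggsLattice.Site.tdist x x' : ℝ) / (P.L : ℝ) ^ j))))
    (h210AB : (regRegionKernels hL1 C Ω (A + B) msq a k K₀).Ineq210 δ₁ Cst)
    (hmixAB : ∀ (j : ℕ) (μ ν : Fin P.d) (x x' : HiggsLattice.Site P 0), Interior k K₀ Ω x → Interior k K₀ Ω x' →
      B3Ineq210MixedRegularRegion.mixedTermR C Ω (A + B) msq a k j μ ν x x'
        ≤ CM * (P.mesh j ^ P.d)⁻¹ * Real.exp (-(δ₁ * ((HiggsLattice.Site.tdist x x' : ℝ) / (P.L : ℝ) ^ j))))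
    (i₀ : Ix N) (hs : 0 ≤ s) (hA : ∀ b : HiggsLattice.PBond P 0, |A b| ≤ s) (hδA : 0 ≤ δA)
    (hregA : ∀ (z : HiggsLattice.Site P 0) (μ ν : Fin P.d), |A ⟨z.shift ν, μ⟩ - A ⟨z, μ⟩| ≤ δA)
    (hAS : ∀ b : HiggsLattice.PBond P 0, A b ≠ 0 → DeepBlk k K₀ Ω b.src ∧ DeepBlk k K₀ Ω b.tgt)
    (ht1 : P.mesh k * (|C.e| * s) ≤ 1) (hcH : 0 ≤ cH)
    (h211 : ∀ (μ : Fin P.d) (x₁ x₂ y : HiggsLattice.Site P 0), Interior k K₀ Ω x₁ → Interior k K₀ Ω x₂ → Interior k K₀ Ω y →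
      x₁ ≠ x₂ → ∀ Γ : List (HiggsLattice.Site P 0), IsAdm x₁ x₂ Γ →
      (∑ i : Ix N, ‖hol C B x₁ Γ (covDeriv C B (propagatorK C Ω B msq a k (cb P N 0 (y, i))) ⟨x₂, μ⟩)
          - covDeriv C B (propagatorK C Ω B msq a k (cb P N 0 (y, i))) ⟨x₁, μ⟩‖)
          / (P.mesh 0 * (HiggsLattice.Site.tdist x₁ x₂ : ℝ)) ^ α
        ≤ ∑ j ∈ Finset.range k, cH * P.mesh j ^ (((1 : ℝ) - α) - (P.d : ℝ)) *
            (Real.exp (-(δ₁ * (P.mesh j)⁻¹ * (P.mesh 0 * (HiggsLattice.Site.tdist x₁ y : ℝ)))) +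
              Real.exp (-(δ₁ * (P.mesh j)⁻¹ * (P.mesh 0 * (HiggsLattice.Site.tdist x₂ y : ℝ)))))) :
    (sect2Smooth116 hL1 C Ω Ω₂ A B msq a k K₀ r₀ m c₁ c₂ eR pR).Ineq25At n 0 α
      (min δG (δ₁ / (4 * (P.L : ℝ)) ^ (n + 1)))
      (CG + (smoothConst P.d m c₁ (c₂ + 2 * c₁) *
          (valC P N C k a δ₁ Cst s δA n + derC P N C k a δ₁ Cst s δA n)
        + ((holC P N C k a δ₁ Cst s δA α cH (n - 1) + holC P N C k a δ₁ Cst s δA α cH n)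
          + P.d * m * mixC P N C k a δ₁ Cst CM s δA n))) := by
  have hL : 1 < P.L := hL1
  have hL1r : (1 : ℝ) ≤ (P.L : ℝ) := by exact_mod_cast P.hL
  have hn : 1 ≤ n := by have := P.hd; omega
  obtain ⟨m₁, rfl⟩ : ∃ m₁, n = m₁ + 1 := ⟨n - 1, by omega⟩
  have hdm : (P.d : ℝ) < (m₁ : ℝ) + 1 := by exact_mod_cast hd
  set M := m₁ + 1 with hM
  have hM1 : M - 1 = m₁ := by omega
  have hM12 : M - 1 + 2 = M + 1 := by omega
  -- thresholds
  have hdM : (P.d : ℝ) < (M : ℝ) := by exact_mod_cast hd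
  have hdV : (P.d : ℝ) < ((m₁ + 1 + 0 : ℕ) : ℝ) + 2 := by push_cast; linarith
  have hdV' : (P.d : ℝ) < ((0 + (m₁ + 1) : ℕ) : ℝ) + 2 := by push_cast; linarith
  have hdD : (P.d : ℝ) < ((m₁ + 1 + 0 : ℕ) : ℝ) + 1 := by push_cast; linarith
  have hdD' : (P.d : ℝ) < ((0 + (m₁ + 1) : ℕ) : ℝ) + 1 := by push_cast; linarith
  have hdH : (P.d : ℝ) < 1 + ((m₁ + 1 + 0 : ℕ) : ℝ) - α := by push_cast; linarith
  have hdH' : (P.d : ℝ) < 1 + ((m₁ + 1 : ℕ) : ℝ) - α := by push_cast; linarith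
  have hdHM : (P.d : ℝ) < 1 + ((M + 1 : ℕ) : ℝ) - α := by push_cast; linarith
  have hd0 : P.d < m₁ + 1 + 0 := by omega
  have hd0' : P.d < 0 + (m₁ + 1) := by omega
  -- signs of the constants
  have hCV : 0 ≤ valC P N C k a δ₁ Cst s δA M := valC_nonneg hL hδ₁ hCst hs hδA M (by linarith)
  have hCD : 0 ≤ derC P N C k a δ₁ Cst s δA M := derC_nonneg hL hδ₁ hCst hs hδA M (by linarith)
  have hCH0 : 0 ≤ holC P N C k a δ₁ Cst s δA α cH (M - 1) := by
    rw [hM1]; exact holC_nonneg hL hδ₁ hCst hs hδA hα1 hcH m₁ hdH'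
  have hCH1 : 0 ≤ holC P N C k a δ₁ Cst s δA α cH M := holC_nonneg hL hδ₁ hCst hs hδA hα1 hcH M hdHM
  have hCH : 0 ≤ holC P N C k a δ₁ Cst s δA α cH (M - 1) + holC P N C k a δ₁ Cst s δA α cH M := add_nonneg hCH0 hCH1
  have hCM' : 0 ≤ mixC P N C k a δ₁ Cst CM s δA M := mixC_nonneg hL hδ₁ hCst hCM ha.le hs hδA (by omega)
  -- the common rate
  set δ : ℝ := δ₁ / (4 * (P.L : ℝ)) ^ (M + 1) with hδdef
  have h4L : (1 : ℝ) ≤ 4 * (P.L : ℝ) := by linarith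
  have h4L0 : (0 : ℝ) < 4 * (P.L : ℝ) := by linarith
  have hδ0 : 0 ≤ δ := div_nonneg hδ₁.le (pow_nonneg h4L0.le _)
  have hδU : δ ≤ rateAt P N C k a Cst s δA δ₁ (P.mesh 0 ^ P.d * Cst) (cK1 P C k Cst s) M := by
    rw [rateAt_closed]
    exact div_le_div_of_nonneg_left hδ₁.le (pow_pos h4L0 _) (pow_le_pow_right₀ h4L (Nat.le_succ M))
  have hδU1 : δ ≤ rateAt P N C k a Cst s δA δ₁ (P.mesh 0 ^ P.d * Cst) (cK1 P C k Cst s) (M + 1) := by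
    rw [rateAt_closed]
  have hδmix : δ ≤ rateAt P N C k a Cst s δA (dipRate P δ₁) (cvDip P N C k a δ₁ Cst CM s δA) (cdDip P N C k a δ₁ Cst CM s δA)
      (M - 1) := by
    rw [mixRate_eq, hM12]
  -- scale factors and geometry
  have hmk : 0 ≤ P.mesh k := (P.mesh_pos k).le
  have hpowM : P.mesh k ^ M ≤ (eR * pR) ^ M := pow_le_pow_left₀ hmk ht M
  have heM : 0 ≤ P.mesh k ^ M := pow_nonneg hmk M
  have hG2 : 0 ≤ P.mesh k ^ 2 * (P.mesh k ^ P.d)⁻¹ := by positivity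
  have hG1 : 0 ≤ P.mesh k * (P.mesh k ^ P.d)⁻¹ := by positivity
  have hG0 : 0 ≤ (P.mesh k ^ P.d)⁻¹ := by positivity
  have hGH : 0 ≤ P.mesh k * (P.mesh k ^ P.d)⁻¹ * (P.mesh k ^ α)⁻¹ := by
    have := Real.rpow_nonneg hmk α; positivity
  have hLk : (0 : ℝ) < (P.L : ℝ) ^ k := by positivity
  have htd : ∀ x x' : HiggsLattice.Site P 0, (0 : ℝ) ≤ (HiggsLattice.Site.tdist x x' : ℝ) / (P.L : ℝ) ^ k :=
    fun x x' => div_nonneg (Nat.cast_nonneg _) hLk.le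
  have htdH : ∀ x₁ x₂ x' : HiggsLattice.Site P 0,
      (0 : ℝ) ≤ min (HiggsLattice.Site.tdist x₁ x' : ℝ) (HiggsLattice.Site.tdist x₂ x' : ℝ) / (P.L : ℝ) ^ k :=
    fun x₁ x₂ x' => div_nonneg (le_min (Nat.cast_nonneg _) (Nat.cast_nonneg _)) hLk.le
  have hq : ∀ x₁ x₂ : HiggsLattice.Site P 0, (0 : ℝ) ≤ (P.mesh 0 * (HiggsLattice.Site.tdist x₁ x₂ : ℝ)) ^ α :=
    fun x₁ x₂ => Real.rpow_nonneg (mul_nonneg (P.mesh_pos 0).le (Nat.cast_nonneg _)) α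
  have e0 : m₁ + 1 + 0 = M := by omega
  have e0' : 0 + (m₁ + 1) = M := by omega
  refine ineq25At_op116_smooth_of_bounds hL2 hk hkK hΩ (m₁ + 1) 0 hα0 hα1.le hc₁ hc₂ ht0 hCG hδ0 hCV hCD hCH hCM' hδG
    ?_ ?_ ?_ ?_ ?_ ?_ ?_ ?_
  · -- hV ← kernel116_value_le_region (n, 0)
    intro x x' hx hx'
    have h := kernel116_value_le_region hδ₁ hδ₁1 hCst h210B h210AB hmsq ha hk hkK i₀ hs hA hδA hregA hAS (m₁ + 1) 0 hdV x x'
      hx hx'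
    rw [e0] at h ⊢
    exact h.trans (entry_mono hCV heM hpowM hG2 hδU (htd x x'))
  · -- hV′ ← kernel116_value_le_region (0, n)
    intro x x' hx hx'
    have h := kernel116_value_le_region hδ₁ hδ₁1 hCst h210B h210AB hmsq ha hk hkK i₀ hs hA hδA hregA hAS 0 (m₁ + 1) hdV' x x'
      hx hx'
    rw [e0'] at h
    rw [e0]
    exact h.trans (entry_mono hCV heM hpowM hG2 hδU (htd x x'))
  · -- hDv ← kernel116_deriv_le_region (n, 0)
    intro μ x x' hx hx'
    have h := kernel116_deriv_le_region hδ₁ hδ₁1 hCst h210B h210AB hmsq ha hk hkK i₀ hs hA hδA hregA hAS (m₁ + 1) 0 hdD μ x x'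
      hx hx'
    rw [e0] at h ⊢
    exact h.trans (entry_mono hCD heM hpowM hG1 hδU (htd x x'))
  · -- hDv′ ← kernel116_deriv_le_region (0, n)
    intro μ x x' hx hx'
    have h := kernel116_deriv_le_region hδ₁ hδ₁1 hCst h210B h210AB hmsq ha hk hkK i₀ hs hA hδA hregA hAS 0 (m₁ + 1) hdD' μ x x'
      hx hx'
    rw [e0'] at h
    rw [e0]
    exact h.trans (entry_mono hCD heM hpowM hG1 hδU (htd x x'))
  · -- hH ← kernel116_holder_le_region (n − 1, 0): outer factor G_k(Ω,B̃)
    intro μ x₁ x₂ x' Γ hx₁ hx₂ hx' hne hΓ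
    have h := kernel116_holder_le_region hδ₁ hδ₁1 hCst h210B h210AB hmsq ha hk hkK i₀ hs hA hδA hregA hAS hα1 hcH h211 m₁ 0 hdH μ
      x₁ x₂ x' hx₁ hx₂ hx' hne Γ hΓ
    rw [show m₁ + 0 = M - 1 by omega, e0] at h
    rw [e0]
    have hK : holC P N C k a δ₁ Cst s δA α cH (M - 1) ≤
        holC P N C k a δ₁ Cst s δA α cH (M - 1) + holC P N C k a δ₁ Cst s δA α cH M := le_add_of_nonneg_right hCH1
    refine h.trans ((entry_mono_holder (hq x₁ x₂) hCH0 heM hpowM hGH hδU (htdH x₁ x₂ x')).trans ?_)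
    have hE : 0 ≤ Real.exp (-(δ * (min (HiggsLattice.Site.tdist x₁ x' : ℝ) (HiggsLattice.Site.tdist x₂ x' : ℝ) / (P.L : ℝ) ^ k))) :=
      (Real.exp_pos _).le
    have hEM : 0 ≤ (eR * pR) ^ M := pow_nonneg ht0 M
    exact mul_le_mul_of_nonneg_right (mul_le_mul_of_nonneg_left
      (mul_le_mul_of_nonneg_right (mul_le_mul_of_nonneg_right hK hEM) hGH) (hq x₁ x₂)) hE
  · -- hH′ ← kernel116_holder_le_zero_left_region′ (0, n): outer factor G_k(Ω,Ã+B̃)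
    intro μ x₁ x₂ x' Γ hx₁ hx₂ hx' hne hΓ
    have h := kernel116_holder_le_zero_left_region' hδ₁ hδ₁1 hCst h210B h210AB hmsq ha hk hkK i₀ hs hA hδA hregA hAS hα1 hcH h211 hmesh
      m₁ hdH' μ x₁ x₂ x' hx₁ hx₂ hx' hne Γ hΓ
    rw [show m₁ + 2 = M + 1 by omega, ← hM1] at h
    rw [e0]
    exact h.trans (entry_mono_holder (hq x₁ x₂) hCH heM hpowM hGH hδU1 (htdH x₁ x₂ x'))
  · -- hM ← kernel116_mixed_le_region (n, 0)
    intro μ ν x x' hx hx'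
    have h := kernel116_mixed_le_region hδ₁ hδ₁1 hCst hCM h210B hmixB h210AB hmixAB hmsq ha hk hkK i₀ hs hA hδA hregA hAS ht1
      (m₁ + 1) 0 hd0 μ ν hx hx'
    rw [e0] at h ⊢
    exact h.trans (entry_mono hCM' heM hpowM hG0 hδmix (htd x x'))
  · -- hM′ ← kernel116_mixed_le_region (0, n)
    intro μ ν x x' hx hx'
    have h := kernel116_mixed_le_region hδ₁ hδ₁1 hCst hCM h210B hmixB h210AB hmixAB hmsq ha hk hkK i₀ hs hA hδA hregA hAS ht1
      0 (m₁ + 1) hd0' μ ν hx hx'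
    rw [e0'] at h
    rw [e0]
    exact h.trans (entry_mono hCM' heM hpowM hG0 hδmix (htd x x'))

end Main

end Literature.MathematicalPhysics.QuantumFieldTheory.Balaban1983to89.B3Ineq25Op116RegularRegionOneSided

end
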